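import Summits.BirchSwinnertonDyer.BirchSwinnertonDyer.Theorems.CMKolyvaginAtInertTwoLagrangianTransversal
import Literature.GroupTheory.FiniteAbelian.MaximalOrderSummand
import HarnessLib

/-!
# Route `CMKolyvaginAtInertTwo`, crux `CMKolyvaginExactAtInertTwo` (stmt-BirchSwinnertonDyer-24277):
# THE LIFT GROUPS WITH (IND) WHEN ONE OF THE TWO TATE–SHAFAREVICH `2`-PARTS IS KILLED BY `2`
# (T5′ of MEMO-T5 §4 / KERNEL-STATUS §12.1 item 7 (d), elementary case — pure algebra)

Seat `bsd-line-cmk2-p1` g14 (cell `bsd-print-cf2`); helper (`--supports stmt-BirchSwinnertonDyer-24277`).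
THEOREMS ONLY: no definition, no named fact, no `sorry`; no item is closed; BSD is not proved by this.
Pure finite-abelian-group algebra; sequel of `…LagrangianTransversal` (transversal Lagrangian of a
symplectic `𝔽_p`-space) on the tree's `FiniteAbelian/MaximalOrderSummand` (Hungerford II §2 Ex. 2).

THE ABSTRACT SITUATION of McCallum's Thm. 5.4 at `p = 2` over `ℚ` (KERNEL-STATUS §§10–12): two
finite groups `S₁` (`= Sel_{2^M}(E/ℚ)`) and `S₂` (`= Sel_{2^M}(E^{(d_K)}/ℚ) = Ш(E^{(d_K)})[2^∞]`,
rank `0`), a surjection `π : S₁ → A` (`A = Ш(E/ℚ)[2^∞]`) whose kernel is the cyclic group `⟨x⟩`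
generated by an element of MAXIMAL order (`x = δ` of a generator of `E(ℚ)/tors`, order `2^M =
exp S₁`), nondegenerate alternating `ℚ/ℤ`-pairings on `A` and on `S₂` (Cassels–Tate), and two
INJECTIVE maps `r₁ : S₁ → G`, `r₂ : S₂ → G` into one group (`G = H¹(K, E[2^M])`, restriction /
twisted restriction; at `2` their images MEET — the "bottom bit" shared by an `E`-class and an
`E^{(d_K)}`-class). WANTED (the hypotheses `hZp hZm hiso hind hIND` of the adaptive telescope
`KolyvaginPairDataTwo.card_mul_card_le_two_pow_of_pair`, p679105, up to the dictionary): subgroups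
`Zp ≤ S₁`, `Zm ≤ S₂` with `Zp ∩ ⟨x⟩ = 0`, `π(Zp)` and `Zm` ISOTROPIC of orders `√#A`, `√#S₂`
(lifts of maximal isotropic subgroups — McCallum p. 307 "let `D` be a maximal isotropic subgroup"),
and **(IND): `r₁(Zp) ∩ r₂(Zm) = 0`**.

* `exists_liftGroups_of_prime_nsmul_left` — (IND) holds when `p · A = 0` (`Ш(E/ℚ)[2^∞]` killed
  by `2`), for ANY `S₂`;
* `exists_liftGroups_of_prime_nsmul_right` — (IND) holds when `p · S₂ = 0` (`Ш(E^{(d_K)}/ℚ)[2^∞]`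
  killed by `2`), for ANY `A`.
Mechanism (no hypothesis on where the two images meet is needed): split `S₁ = ⟨x⟩ ⊕ A'`
(maximal-order summand), so `π : A' ≅ A`; on the filtered side take the two summands `L, L'` of a
Lagrangian decomposition — their collision subgroups with the other side are disjoint, so one of
them, `W`, has `(#W)² ≤ #(collisions) ≤ #(elementary side)` (halving); on the elementary side take a
Lagrangian transversal to `W` (`exists_lagrangian_inf_eq_bot_of_prime_nsmul`).

NOT here (KERNEL-STATUS §13): the doubly filtered case (both `2`-parts of exponent `≥ 4`), where the
two summands `L, L'` do not suffice and graph Lagrangians are needed; the dictionary to `pairData`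
(inflation–restriction for `E` and the twist, the Cassels–Tate pairings over `ℚ`) = T2.

References: [McCallumLMS1991] §5 Thm. 5.4 and p. 307; [Hungerford1974] Ch. II §2 Ex. 2;
[TignolAmitsur1986SymplecticModules] Thm. 4.1.
-/

-- single-conjunct summit: `Summit.BirchSwinnertonDyer.BirchSwinnertonDyer.…` repeats the name by design
set_option linter.dupNamespace false
set_option autoImplicit false

noncomputable section

open AddSubgroup Literature.GroupTheory.FiniteAbelian

namespace Summit.BirchSwinnertonDyer.BirchSwinnertonDyer.Theorems.KolyvaginLiftGroupsTwo

universe u v w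

section LiftGroups

variable {G : Type w} [AddCommGroup G]
  {S₁ : Type u} [AddCommGroup S₁] [Finite S₁]
  {S₂ : Type u} [AddCommGroup S₂] [Finite S₂]
  {A : Type v} [AddCommGroup A]

/-! ### The summand `A' ≅ A` complementary to `⟨x⟩` -/

/-- **`S₁ = ⟨x⟩ ⊕ A'` with `π : A' ≅ A`.** If `π : S₁ → A` is onto with kernel `⟨x⟩` and `x` has
maximal order (`ord x = exp S₁`), then `⟨x⟩` has a complement `A'` (Hungerford II §2 Ex. 2, tree
`exists_isCompl_zmultiples_of_addOrderOf_eq_exponent`) and `π` restricted to `A'` is bijective.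
[cite: Hungerford1974, Ch. II §2 Exercise 2 (PDF p. 141)] -/
theorem exists_isCompl_bijective_restrict (π : S₁ →+ A) (hπ : Function.Surjective π) (x : S₁)
    (hker : π.ker = zmultiples x) (hx : addOrderOf x = AddMonoid.exponent S₁) :
    ∃ A' : AddSubgroup S₁, IsCompl (zmultiples x) A' ∧ Function.Bijective (π.comp A'.subtype) := by
  obtain ⟨A', hc⟩ := exists_isCompl_zmultiples_of_addOrderOf_eq_exponent hx
  refine ⟨A', hc, ?_, ?_⟩
  · -- injective: `ker π ∩ A' = ⟨x⟩ ∩ A' = 0`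
    rw [injective_iff_map_eq_zero]
    intro a ha
    have hak : (a : S₁) ∈ π.ker := by rwa [AddMonoidHom.mem_ker]
    rw [hker] at hak
    exact Subtype.ext ((AddSubgroup.disjoint_def.mp hc.disjoint) hak a.2)
  · -- surjective: `π(A') = π(⟨x⟩ + A') = π(S₁)`
    intro b
    obtain ⟨s, rfl⟩ := hπ b
    have hs : s ∈ zmultiples x ⊔ A' := by rw [hc.sup_eq_top]; exact AddSubgroup.mem_top s
    obtain ⟨k, hk, a, ha, rfl⟩ := AddSubgroup.mem_sup.mp hs
    refine ⟨⟨a, ha⟩, ?_⟩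
    have hk0 : π k = 0 := by rw [← AddMonoidHom.mem_ker, hker]; exact hk
    rw [AddMonoidHom.comp_apply, AddSubgroup.coe_subtype, map_add, hk0, zero_add]

/-- The pairing `B_A` pulled back along a map `f : X → A` is alternating if `B_A` is. [folklore] -/
private theorem alt_pullback {X : Type*} [AddCommGroup X] (BA : A →+ A →+ AddCircle (1 : ℚ))
    (halt : ∀ a, BA a a = 0) (f : X →+ A) : ∀ z : X, (BA.comp f).compl₂ f z z = 0 :=
  fun z ↦ by rw [AddMonoidHom.compl₂_apply, AddMonoidHom.comp_apply]; exact halt (f z)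

/-- The pairing `B_A` pulled back along a BIJECTION `f : X → A` is nondegenerate if `B_A` is.
[folklore] -/
private theorem nondeg_pullback {X : Type*} [AddCommGroup X] (BA : A →+ A →+ AddCircle (1 : ℚ))
    (hnd : ∀ a, (∀ b, BA a b = 0) → a = 0) (f : X →+ A) (hf : Function.Bijective f) :
    ∀ z : X, (∀ w : X, (BA.comp f).compl₂ f z w = 0) → z = 0 := by
  intro z hz
  have h0 : f z = 0 := hnd (f z) fun b ↦ by
    obtain ⟨w, rfl⟩ := hf.2 b
    have := hz w
    rwa [AddMonoidHom.compl₂_apply, AddMonoidHom.comp_apply] at this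
  exact hf.1 (by rw [h0, map_zero])

/-- Images under injective maps have the same order. [folklore] -/
private theorem card_map_of_injective {X Y : Type*} [AddCommGroup X] [AddCommGroup Y]
    (f : X →+ Y) (hf : Function.Injective f) (H : AddSubgroup X) :
    Nat.card (H.map f) = Nat.card H :=
  (Nat.card_congr (AddSubgroup.equivMapOfInjective H f hf).toEquiv).symm

/-- An image of a finite subgroup is finite. [folklore] -/
private theorem finite_map {X Y : Type*} [AddCommGroup X] [AddCommGroup Y] (f : X →+ Y)
    (H : AddSubgroup X) [Finite H] : Finite (H.map f) := by
  haveI : Finite (H.map f : Set Y) := (Set.toFinite (H : Set X)).image f |>.to_subtype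
  exact this

/-! ### (IND) when the `E`-side `Ш[2^∞]` is killed by the prime -/

/-- **The lift groups with (IND), `A` elementary.** In the abstract situation of the module
docstring (`π : S₁ ↠ A` with kernel `⟨x⟩`, `ord x = exp S₁`; nondegenerate alternating `B_A` on `A`
with `p · A = 0` for a prime `p`; nondegenerate alternating `B_B` on `S₂`; injective `r₁ : S₁ → G`,
`r₂ : S₂ → G`): there are `Zp ≤ S₁` and `Zm ≤ S₂` with `Zp ∩ ⟨x⟩ = 0`, `π(Zp)` isotropic with
`(#Zp)² = #A`, `Zm` isotropic with `(#Zm)² = #S₂`, and **`r₁(Zp) ∩ r₂(Zm) = 0`** — i.e. maximal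
isotropic subgroups of the two Cassels–Tate modules (McCallum 1991 §5, p. 307) and a lift group of
the first, independent of `x`, whose images in `G` do not collide.
[cite: McCallumLMS1991, §5 Thm. 5.4 (proof, p. 307: the maximal isotropic subgroup D)] -/
theorem exists_liftGroups_of_prime_nsmul_left (π : S₁ →+ A) (hπ : Function.Surjective π) (x : S₁)
    (hker : π.ker = zmultiples x) (hx : addOrderOf x = AddMonoid.exponent S₁)
    (BA : A →+ A →+ AddCircle (1 : ℚ)) (hAalt : ∀ a, BA a a = 0)
    (hAnd : ∀ a, (∀ b, BA a b = 0) → a = 0) {p : ℕ} (hp : p.Prime) (hpA : ∀ a : A, p • a = 0)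
    (BB : S₂ →+ S₂ →+ AddCircle (1 : ℚ)) (hBalt : ∀ v, BB v v = 0)
    (hBnd : ∀ v, (∀ w, BB v w = 0) → v = 0)
    (r₁ : S₁ →+ G) (r₂ : S₂ →+ G) (hr₁ : Function.Injective r₁) (hr₂ : Function.Injective r₂) :
    ∃ (Zp : AddSubgroup S₁) (Zm : AddSubgroup S₂),
      Disjoint (zmultiples x) Zp ∧
      (∀ a ∈ Zp, ∀ b ∈ Zp, BA (π a) (π b) = 0) ∧ Nat.card Zp ^ 2 = Nat.card A ∧
      (∀ v ∈ Zm, ∀ w ∈ Zm, BB v w = 0) ∧ Nat.card Zm ^ 2 = Nat.card S₂ ∧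
      (∀ u ∈ Zp, ∀ v ∈ Zm, r₁ u = r₂ v → u = 0 ∧ v = 0) := by
  classical
  -- `S₁ = ⟨x⟩ ⊕ A'`, `π : A' ≅ A`, the transported pairing `B'` on `A'`
  obtain ⟨A', hc, hbij⟩ := exists_isCompl_bijective_restrict π hπ x hker hx
  set ι : A' →+ S₁ := A'.subtype with hι_def
  set πA : A' →+ A := π.comp ι with hπA_def
  set B' : A' →+ A' →+ AddCircle (1 : ℚ) := (BA.comp πA).compl₂ πA with hB'_def
  have hB' : ∀ a b : A', B' a b = BA (π a) (π b) := fun a b ↦ rfl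
  have halt' : ∀ a : A', B' a a = 0 := alt_pullback BA hAalt πA
  have hnd' : ∀ a : A', (∀ b : A', B' a b = 0) → a = 0 := nondeg_pullback BA hAnd πA hbij
  have hpA' : ∀ a : A', p • a = 0 := fun a ↦ hbij.1 (by rw [map_nsmul, hpA, map_zero])
  have hcardA' : Nat.card A' = Nat.card A := Nat.card_congr (Equiv.ofBijective πA hbij)
  have hrι : Function.Injective (r₁.comp ι) := hr₁.comp A'.subtype_injective
  -- the collision subgroup `C = {v ∈ S₂ : r₂ v ∈ r₁(A')}` and its order `≤ #A'`
  set C : AddSubgroup S₂ := (A'.map r₁).comap r₂ with hC_def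
  haveI : Finite (A'.map r₁) := finite_map r₁ A'
  have hCmap : C.map r₂ = r₂.range ⊓ A'.map r₁ := by rw [hC_def, AddSubgroup.map_comap_eq]
  have hcardC : Nat.card C ≤ Nat.card A' := by
    rw [← card_map_of_injective r₂ hr₂ C, ← card_map_of_injective r₁ hr₁ A', hCmap]
    exact AddSubgroup.card_le_of_le inf_le_right
  -- one summand `Zm` of a Lagrangian decomposition of `S₂` meets `C` in order `≤ √#C`
  obtain ⟨Zm, hZm_iso, hZm_card, hZm_inf⟩ := exists_isotropic_sq_card_inf_sq_le BB hBalt hBnd C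
  -- `Y = {a ∈ A' : r₁ a ∈ r₂(Zm)}` has `(#Y)² ≤ #A'`
  set Y : AddSubgroup A' := (Zm.map r₂).comap (r₁.comp ι) with hY_def
  have hcardY : Nat.card Y = Nat.card ↥(Zm ⊓ C) := by
    have h1 : Y.map (r₁.comp ι) = A'.map r₁ ⊓ Zm.map r₂ := by
      rw [hY_def, AddSubgroup.map_comap_eq, AddMonoidHom.range_comp, hι_def,
        AddSubgroup.range_subtype]
    have h2 : (Zm ⊓ C).map r₂ = A'.map r₁ ⊓ Zm.map r₂ := by
      rw [AddSubgroup.map_inf _ _ r₂ hr₂, hCmap, inf_comm, inf_assoc]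
      exact inf_eq_right.mpr (inf_le_right.trans (AddSubgroup.map_le_range r₂ Zm))
    rw [← card_map_of_injective _ hrι Y, ← card_map_of_injective r₂ hr₂ (Zm ⊓ C), h1, h2]
  have hY : Nat.card Y ^ 2 ≤ Nat.card A' := by
    rw [hcardY]; exact hZm_inf.trans hcardC
  -- a Lagrangian `D'` of `A'` transversal to `Y`
  obtain ⟨D', hD'_iso, hD'_card, hD'_inf⟩ :=
    exists_lagrangian_inf_eq_bot_of_prime_nsmul B' halt' hnd' hp hpA' Y hY
  refine ⟨D'.map ι, Zm, hc.disjoint.mono_right (by rw [hι_def]; exact AddSubgroup.map_subtype_le D'),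
    ?_, ?_, hZm_iso, hZm_card, ?_⟩
  · -- `π(Zp)` isotropic
    intro a ha b hb
    obtain ⟨a₀, ha₀, rfl⟩ := AddSubgroup.mem_map.mp ha
    obtain ⟨b₀, hb₀, rfl⟩ := AddSubgroup.mem_map.mp hb
    have := hD'_iso a₀ ha₀ b₀ hb₀
    rwa [hB'] at this
  · -- order
    rw [hι_def, card_map_of_injective _ A'.subtype_injective, hD'_card, hcardA']
  · -- (IND)
    intro u hu v hv huv
    obtain ⟨a₀, ha₀, rfl⟩ := AddSubgroup.mem_map.mp hu
    have haY : a₀ ∈ Y := by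
      rw [hY_def, AddSubgroup.mem_comap, AddMonoidHom.comp_apply, huv]
      exact AddSubgroup.mem_map_of_mem r₂ hv
    have ha0 : a₀ = 0 := by
      have : a₀ ∈ D' ⊓ Y := AddSubgroup.mem_inf.mpr ⟨ha₀, haY⟩
      rwa [hD'_inf, AddSubgroup.mem_bot] at this
    subst ha0
    refine ⟨by rw [map_zero], hr₂ ?_⟩
    rw [← huv, map_zero, map_zero, map_zero]

/-! ### (IND) when the `E^{(d_K)}`-side `Ш[2^∞]` is killed by the prime -/

/-- **The lift groups with (IND), `S₂` elementary.** Same situation, now with `p · S₂ = 0` for a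
prime `p` and `A` arbitrary: there are `Zp ≤ S₁`, `Zm ≤ S₂` with `Zp ∩ ⟨x⟩ = 0`, `π(Zp)` isotropic
with `(#Zp)² = #A`, `Zm` isotropic with `(#Zm)² = #S₂`, and `r₁(Zp) ∩ r₂(Zm) = 0`.
[cite: McCallumLMS1991, §5 Thm. 5.4 (proof, p. 307: the maximal isotropic subgroup D)] -/
theorem exists_liftGroups_of_prime_nsmul_right (π : S₁ →+ A) (hπ : Function.Surjective π) (x : S₁)
    (hker : π.ker = zmultiples x) (hx : addOrderOf x = AddMonoid.exponent S₁)
    (BA : A →+ A →+ AddCircle (1 : ℚ)) (hAalt : ∀ a, BA a a = 0)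
    (hAnd : ∀ a, (∀ b, BA a b = 0) → a = 0)
    (BB : S₂ →+ S₂ →+ AddCircle (1 : ℚ)) (hBalt : ∀ v, BB v v = 0)
    (hBnd : ∀ v, (∀ w, BB v w = 0) → v = 0) {p : ℕ} (hp : p.Prime) (hpB : ∀ v : S₂, p • v = 0)
    (r₁ : S₁ →+ G) (r₂ : S₂ →+ G) (hr₁ : Function.Injective r₁) (hr₂ : Function.Injective r₂) :
    ∃ (Zp : AddSubgroup S₁) (Zm : AddSubgroup S₂),
      Disjoint (zmultiples x) Zp ∧
      (∀ a ∈ Zp, ∀ b ∈ Zp, BA (π a) (π b) = 0) ∧ Nat.card Zp ^ 2 = Nat.card A ∧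
      (∀ v ∈ Zm, ∀ w ∈ Zm, BB v w = 0) ∧ Nat.card Zm ^ 2 = Nat.card S₂ ∧
      (∀ u ∈ Zp, ∀ v ∈ Zm, r₁ u = r₂ v → u = 0 ∧ v = 0) := by
  classical
  obtain ⟨A', hc, hbij⟩ := exists_isCompl_bijective_restrict π hπ x hker hx
  set ι : A' →+ S₁ := A'.subtype with hι_def
  set πA : A' →+ A := π.comp ι with hπA_def
  set B' : A' →+ A' →+ AddCircle (1 : ℚ) := (BA.comp πA).compl₂ πA with hB'_def
  have hB' : ∀ a b : A', B' a b = BA (π a) (π b) := fun a b ↦ rfl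
  have halt' : ∀ a : A', B' a a = 0 := alt_pullback BA hAalt πA
  have hnd' : ∀ a : A', (∀ b : A', B' a b = 0) → a = 0 := nondeg_pullback BA hAnd πA hbij
  have hcardA' : Nat.card A' = Nat.card A := Nat.card_congr (Equiv.ofBijective πA hbij)
  have hrι : Function.Injective (r₁.comp ι) := hr₁.comp A'.subtype_injective
  have hrange : (r₁.comp ι).range = A'.map r₁ := by
    rw [AddMonoidHom.range_comp, hι_def, AddSubgroup.range_subtype]
  -- the collision subgroup `C = {a ∈ A' : r₁ a ∈ r₂(S₂)}`, of order `≤ #S₂`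
  set C : AddSubgroup A' := r₂.range.comap (r₁.comp ι) with hC_def
  have hCmap : C.map (r₁.comp ι) = A'.map r₁ ⊓ r₂.range := by
    rw [hC_def, AddSubgroup.map_comap_eq, hrange]
  haveI : Finite r₂.range := by
    rw [AddMonoidHom.range_eq_map]; exact finite_map r₂ ⊤
  have hcardC : Nat.card C ≤ Nat.card S₂ := by
    rw [← card_map_of_injective _ hrι C, hCmap, ← AddSubgroup.card_top (G := S₂),
      ← card_map_of_injective r₂ hr₂ ⊤, ← AddMonoidHom.range_eq_map]
    exact AddSubgroup.card_le_of_le inf_le_right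
  -- one summand `D'` of a Lagrangian decomposition of `A'` meets `C` in order `≤ √#C`
  obtain ⟨D', hD'_iso, hD'_card, hD'_inf⟩ := exists_isotropic_sq_card_inf_sq_le B' halt' hnd' C
  -- `Y = {v ∈ S₂ : r₂ v ∈ r₁(D')}` has `(#Y)² ≤ #S₂`
  set Y : AddSubgroup S₂ := (D'.map (r₁.comp ι)).comap r₂ with hY_def
  haveI : Finite (D'.map (r₁.comp ι)) := finite_map _ D'
  have hcardY : Nat.card Y = Nat.card ↥(D' ⊓ C) := by
    have h1 : Y.map r₂ = r₂.range ⊓ D'.map (r₁.comp ι) := by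
      rw [hY_def, AddSubgroup.map_comap_eq]
    have h2 : (D' ⊓ C).map (r₁.comp ι) = r₂.range ⊓ D'.map (r₁.comp ι) := by
      rw [AddSubgroup.map_inf _ _ _ hrι, hCmap, inf_comm, inf_assoc]
      exact inf_eq_right.mpr (inf_le_right.trans ((AddSubgroup.map_le_range _ D').trans_eq hrange))
    rw [← card_map_of_injective r₂ hr₂ Y, ← card_map_of_injective _ hrι (D' ⊓ C), h1, h2]
  have hY : Nat.card Y ^ 2 ≤ Nat.card S₂ := by
    rw [hcardY]; exact hD'_inf.trans hcardC
  -- a Lagrangian `Zm` of `S₂` transversal to `Y`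
  obtain ⟨Zm, hZm_iso, hZm_card, hZm_inf⟩ :=
    exists_lagrangian_inf_eq_bot_of_prime_nsmul BB hBalt hBnd hp hpB Y hY
  refine ⟨D'.map ι, Zm, hc.disjoint.mono_right (by rw [hι_def]; exact AddSubgroup.map_subtype_le D'),
    ?_, ?_, hZm_iso, hZm_card, ?_⟩
  · intro a ha b hb
    obtain ⟨a₀, ha₀, rfl⟩ := AddSubgroup.mem_map.mp ha
    obtain ⟨b₀, hb₀, rfl⟩ := AddSubgroup.mem_map.mp hb
    have := hD'_iso a₀ ha₀ b₀ hb₀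
    rwa [hB'] at this
  · rw [hι_def, card_map_of_injective _ A'.subtype_injective, hD'_card, hcardA']
  · intro u hu v hv huv
    obtain ⟨a₀, ha₀, rfl⟩ := AddSubgroup.mem_map.mp hu
    have hvY : v ∈ Y := by
      rw [hY_def, AddSubgroup.mem_comap, ← huv]
      exact AddSubgroup.mem_map_of_mem _ ha₀
    have hv0 : v = 0 := by
      have : v ∈ Zm ⊓ Y := AddSubgroup.mem_inf.mpr ⟨hv, hvY⟩
      rwa [hZm_inf, AddSubgroup.mem_bot] at this
    subst hv0
    refine ⟨?_, rfl⟩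
    have h0 : r₁ (ι a₀) = 0 := by rw [huv, map_zero]
    have : ι a₀ = 0 := hr₁ (by rw [h0, map_zero])
    exact this

end LiftGroups

end Summit.BirchSwinnertonDyer.BirchSwinnertonDyer.Theorems.KolyvaginLiftGroupsTwo

end
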